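import Summits.FinalStateConjecture.FinalStateConjecture.Theorems.EIHFluxBalanceModulatedKerrHandoffOneHoleLeibniz

/-!
# Route EIHFluxBalance — `ModulatedKerrHandoff`, stub `stub_oneHoleMatching`: differences of compositions

Helper file for the crux `stmt-FinalStateConjecture-10167`
(`Summit.FinalStateConjecture.FinalStateConjecture.Theses.EIHFluxBalance.ModulatedKerrHandoff`),
line `photon-rocket-modulation`, stub `stub_oneHoleMatching` (one-hole profile matching); continuation
of `…OneHoleCalculus`, `…OneHoleLeibniz`.

The one-hole matching compares `x ↦ 𝔉(p₁(x))` (retarded moduli) with `x ↦ 𝔉(p₀(x))` (instantaneous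
moduli) in `C³`, where `𝔉` is one smooth kernel on a parameter space `P` and `p₁ − p₀` is SMALL together
with three derivatives. This file proves the abstract mechanism:

* `fderiv_comp_eventuallyEq`, `fderiv_sub_eventuallyEq` — the chain and difference rules as identities
  of FUNCTIONS near a point (so that iterated derivatives can be taken on both sides);
* `ck₁_comp_of_small_inner` — if the inner function has small derivatives of orders `1 … n+1`
  (`≤ δ ≤ 1`), the composition has derivatives of orders `1 … n+1` bounded LINEARLY in `δ`
  (`2ⁿ n! C δ`; the mechanism by which tameness of a boost path `u ↦ Λ(u)` passes to `u ↦ Λ(u)⁻¹`);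
* `exists_norm_iteratedFDeriv_comp_sub_comp_le` — **the difference lemma**: for every order `j` and
  sizes `B`, `D` there is `K` with
  `‖Dⁱ[𝔉 ∘ p₁ − 𝔉 ∘ p₀](x)‖ ≤ K · λ` (`i ≤ j`) whenever the derivatives of orders `1 … j+1` of `𝔉`
  are `≤ B` on a set `V` containing the segment `[p₀ x, p₁ x]` (inside an open set of smoothness),
  the positive-order sizes of `p₀`, `p₁` at `x` are `≤ D`, and all derivatives of orders `≤ j` of
  `p₁ − p₀` at `x` are `≤ λ`. Proof: induction on `j` (telescoping
  `D(𝔉∘p₁) − D(𝔉∘p₀) = (𝔉′∘p₁)·(Dp₁ − Dp₀) + (𝔉′∘p₁ − 𝔉′∘p₀)·Dp₀`, the second bracket being the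
  same problem for `𝔉′ = D𝔉` one order lower; order zero is the mean value inequality on the
  segment). Dieudonné 1960, (8.5.4), (8.12.10). [folklore]
-/

noncomputable section

-- `Summit.<S>.<S>.…` (single-problem summit, D-0017) trips core's duplicate-namespace linter.
set_option linter.dupNamespace false

open Set Filter Function
open scoped Topology ContDiff

namespace Summit.FinalStateConjecture.FinalStateConjecture.Theorems

namespace OneHole

universe u

variable {E F G : Type*} [NormedAddCommGroup E] [NormedSpace ℝ E] [NormedAddCommGroup F]
  [NormedSpace ℝ F] [NormedAddCommGroup G] [NormedSpace ℝ G]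

/-! ### Chain and difference rules as identities of functions near a point -/

/-- A `C^{m+1}` function at a point is differentiable at all nearby points. [folklore] -/
theorem eventually_differentiableAt {f : E → F} {x : E} {m : ℕ} (hf : ContDiffAt ℝ (m + 1 : ℕ) f x) :
    ∀ᶠ y in 𝓝 x, DifferentiableAt ℝ f y :=
  (hf.eventually (by simp)).mono fun _ hy ↦ hy.differentiableAt (by simp)

/-- **Chain rule near a point**: `D(g ∘ f) = (Dg ∘ f) ∘L Df` as functions on a neighbourhood of `x`,
for `g`, `f` of class `C^{m+1}` at `f x`, `x`. [folklore] -/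
theorem fderiv_comp_eventuallyEq {g : F → G} {f : E → F} {x : E} {m : ℕ}
    (hg : ContDiffAt ℝ (m + 1 : ℕ) g (f x)) (hf : ContDiffAt ℝ (m + 1 : ℕ) f x) :
    fderiv ℝ (fun y ↦ g (f y)) =ᶠ[𝓝 x] fun y ↦ (fderiv ℝ g (f y)).comp (fderiv ℝ f y) := by
  have hgf : ∀ᶠ y in 𝓝 x, DifferentiableAt ℝ g (f y) :=
    hf.continuousAt.eventually (eventually_differentiableAt hg)
  filter_upwards [eventually_differentiableAt hf, hgf] with y hy hgy
  exact (hgy.hasFDerivAt.comp y hy.hasFDerivAt).fderiv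

/-- **Difference rule near a point**: `D(f − g) = Df − Dg` as functions on a neighbourhood of `x`.
[folklore] -/
theorem fderiv_sub_eventuallyEq {f g : E → F} {x : E} {m : ℕ} (hf : ContDiffAt ℝ (m + 1 : ℕ) f x)
    (hg : ContDiffAt ℝ (m + 1 : ℕ) g x) :
    fderiv ℝ (fun y ↦ f y - g y) =ᶠ[𝓝 x] fun y ↦ fderiv ℝ f y - fderiv ℝ g y := by
  filter_upwards [eventually_differentiableAt hf, eventually_differentiableAt hg] with y hfy hgy
  exact (hfy.hasFDerivAt.sub hgy.hasFDerivAt).fderiv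

/-! ### Composition with an inner function having small derivatives -/

/-- **Inner function with small derivatives.** If `g` has size `≤ C` (orders `0 … n+1`) at `f x` and
the derivatives of orders `1 … n+1` of `f` at `x` are `≤ δ ≤ 1`, then the derivatives of orders
`1 … n+1` of `g ∘ f` at `x` are `≤ 2ⁿ n! C δ` — linear in `δ` (write `D(g∘f) = (Dg∘f)·Df`, a
pairing of a bounded factor with a small one). [folklore] -/
theorem ck₁_comp_of_small_inner {n : ℕ} {g : F → G} {f : E → F} {x : E} {C δ : ℝ}
    (hg : ContDiffAt ℝ (n + 1 : ℕ) g (f x) ∧ ∀ i ≤ n + 1, ‖iteratedFDeriv ℝ i g (f x)‖ ≤ C)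
    (hf : ContDiffAt ℝ (n + 1 : ℕ) f x ∧ ∀ i, 1 ≤ i → i ≤ n + 1 → ‖iteratedFDeriv ℝ i f x‖ ≤ δ)
    (hδ : δ ≤ 1) :
    ContDiffAt ℝ (n + 1 : ℕ) (fun y ↦ g (f y)) x ∧
      ∀ i, 1 ≤ i → i ≤ n + 1 →
        ‖iteratedFDeriv ℝ i (fun y ↦ g (f y)) x‖ ≤ 2 ^ n * n.factorial * C * δ := by
  refine ⟨hg.1.comp x hf.1, fun i hi1 hi ↦ ?_⟩
  obtain ⟨k, rfl⟩ := Nat.exists_eq_add_of_le' hi1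
  have hk : k ≤ n := by omega
  rw [← norm_iteratedFDeriv_fderiv, ((fderiv_comp_eventuallyEq hg.1 hf.1).iteratedFDeriv ℝ k).eq_of_nhds]
  -- sizes of the two factors at order `k`
  have hg' : ContDiffAt ℝ k (fderiv ℝ g) (f x) ∧ ∀ i ≤ k, ‖iteratedFDeriv ℝ i (fderiv ℝ g) (f x)‖ ≤ C :=
    ⟨(hg.1.fderiv_right (m := k) (by exact_mod_cast (by omega : k + 1 ≤ n + 1))), fun i hi ↦ by
      rw [norm_iteratedFDeriv_fderiv]; exact hg.2 (i + 1) (by omega)⟩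
  have hf₁ : ContDiffAt ℝ k f x ∧ ∀ i, 1 ≤ i → i ≤ k → ‖iteratedFDeriv ℝ i f x‖ ≤ δ :=
    ck₁_mono hf (by omega) le_rfl
  have h1 := ck_comp hg' hf₁
  rw [max_eq_left hδ, one_pow, mul_one] at h1
  have hf' : ContDiffAt ℝ k (fderiv ℝ f) x ∧ ∀ i ≤ k, ‖iteratedFDeriv ℝ i (fderiv ℝ f) x‖ ≤ δ :=
    ck_fderiv (ck₁_mono hf (by omega) le_rfl)
  have h2 := ck_clm_comp h1 hf'
  refine (h2.2 k le_rfl).trans ?_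
  have hC : 0 ≤ C := ck_nonneg hg'
  have hδ0 : 0 ≤ δ := ck_nonneg hf'
  have h3 : (2 : ℝ) ^ k ≤ 2 ^ n := pow_le_pow_right₀ one_le_two hk
  have h4 : (k.factorial : ℝ) ≤ n.factorial := by exact_mod_cast Nat.factorial_le hk
  calc (2 : ℝ) ^ k * (k.factorial * C) * δ = 2 ^ k * k.factorial * (C * δ) := by ring
    _ ≤ 2 ^ n * n.factorial * (C * δ) := by gcongr
    _ = 2 ^ n * n.factorial * C * δ := by ring

/-! ### The difference lemma -/

/-- **Order zero: the mean value inequality along the segment of parameters.** If `𝔉` is differentiable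
on an open `O ⊇ [q₀, q₁]` with `‖D𝔉‖ ≤ B` on the segment, then `‖𝔉 q₁ − 𝔉 q₀‖ ≤ B ‖q₁ − q₀‖`
(Dieudonné 1960, (8.5.4)). [folklore] -/
theorem norm_sub_le_of_segment {P : Type*} [NormedAddCommGroup P] [NormedSpace ℝ P] {𝔉 : P → F}
    {O : Set P} {q₀ q₁ : P} {B : ℝ} {m : ℕ} (hO : IsOpen O) (h𝔉 : ContDiffOn ℝ (m + 1 : ℕ) 𝔉 O)
    (hseg : segment ℝ q₀ q₁ ⊆ O) (hB : ∀ q ∈ segment ℝ q₀ q₁, ‖iteratedFDeriv ℝ 1 𝔉 q‖ ≤ B) :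
    ‖𝔉 q₁ - 𝔉 q₀‖ ≤ B * ‖q₁ - q₀‖ := by
  refine Convex.norm_image_sub_le_of_norm_fderiv_le (𝕜 := ℝ) (f := 𝔉) (s := segment ℝ q₀ q₁)
    (fun q hq ↦ ?_) (fun q hq ↦ ?_) (convex_segment q₀ q₁) (left_mem_segment ℝ q₀ q₁)
    (right_mem_segment ℝ q₀ q₁)
  · exact ((h𝔉 q (hseg hq)).contDiffAt (hO.mem_nhds (hseg hq))).differentiableAt (by simp)
  · have h := hB q hq
    rwa [← norm_iteratedFDeriv_fderiv, norm_iteratedFDeriv_zero] at h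

/-- Algebra of the telescoping: `A₁ ∘ B₁ − A₀ ∘ B₀ = A₁ ∘ (B₁ − B₀) + (A₁ − A₀) ∘ B₀` for continuous
linear maps. [folklore] -/
theorem comp_sub_comp_eq {P : Type*} [NormedAddCommGroup P] [NormedSpace ℝ P] (A₁ A₀ : P →L[ℝ] F)
    (B₁ B₀ : E →L[ℝ] P) :
    A₁.comp B₁ - A₀.comp B₀ = A₁.comp (B₁ - B₀) + (A₁ - A₀).comp B₀ := by
  simp only [ContinuousLinearMap.comp_sub, ContinuousLinearMap.sub_comp]
  abel

/-- **The difference lemma.** For every order `j` and sizes `B`, `D` there is `K ≥ 0` such that: for every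
smooth kernel `𝔉 : P → F` (class `C^{j+1}` on an open `O`), every set `V ⊆ O` on which the derivatives
of orders `1 … j+1` of `𝔉` are `≤ B`, every pair of parameter maps `p₀, p₁ : E → P` of class `Cʲ` at `x`
with positive-order sizes `≤ D` (`D ≥ 1`) whose segment `[p₀ x, p₁ x]` lies in `V`, and every `λ`
bounding the derivatives of orders `≤ j` of `p₁ − p₀` at `x`:
`‖Dⁱ[𝔉 ∘ p₁ − 𝔉 ∘ p₀](x)‖ ≤ K λ` for all `i ≤ j`. Telescoping induction on `j` through
`D(𝔉∘p₁) − D(𝔉∘p₀) = (𝔉′∘p₁)·D(p₁ − p₀) + (𝔉′∘p₁ − 𝔉′∘p₀)·Dp₀` (Dieudonné 1960, (8.12.10)); the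
parameter space and the target must live in one universe so that the induction may replace `F` by
`P →L[ℝ] F`. [folklore] -/
theorem exists_norm_iteratedFDeriv_comp_sub_comp_le {P : Type u} [NormedAddCommGroup P]
    [NormedSpace ℝ P] (j : ℕ) (B D : ℝ) :
    ∃ K : ℝ, 0 ≤ K ∧ ∀ {F : Type u} [NormedAddCommGroup F] [NormedSpace ℝ F]
      {𝔉 : P → F} {O V : Set P} {p₀ p₁ : E → P} {x : E} {lam : ℝ},
      IsOpen O → V ⊆ O → ContDiffOn ℝ (j + 1 : ℕ) 𝔉 O →
      (∀ q ∈ V, ∀ i, 1 ≤ i → i ≤ j + 1 → ‖iteratedFDeriv ℝ i 𝔉 q‖ ≤ B) →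
      segment ℝ (p₀ x) (p₁ x) ⊆ V →
      (ContDiffAt ℝ j p₀ x ∧ ∀ i, 1 ≤ i → i ≤ j → ‖iteratedFDeriv ℝ i p₀ x‖ ≤ D) →
      (ContDiffAt ℝ j p₁ x ∧ ∀ i, 1 ≤ i → i ≤ j → ‖iteratedFDeriv ℝ i p₁ x‖ ≤ D) →
      1 ≤ D →
      (∀ i ≤ j, ‖iteratedFDeriv ℝ i (fun y ↦ p₁ y - p₀ y) x‖ ≤ lam) →
      ∀ i ≤ j, ‖iteratedFDeriv ℝ i (fun y ↦ 𝔉 (p₁ y) - 𝔉 (p₀ y)) x‖ ≤ K * lam := by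
  induction j with
  | zero =>
    refine ⟨max B 0, le_max_right _ _, ?_⟩
    intro F _ _ 𝔉 O V p₀ p₁ x lam hO hVO h𝔉 hB hseg hp₀ hp₁ hD hδ i hi
    obtain rfl : i = 0 := Nat.le_zero.mp hi
    rw [norm_iteratedFDeriv_zero]
    have h0 := hδ 0 le_rfl
    rw [norm_iteratedFDeriv_zero] at h0
    have hmvt := norm_sub_le_of_segment (m := 0) hO h𝔉 (hseg.trans hVO)
      (fun q hq ↦ hB q (hseg hq) 1 le_rfl le_rfl)
    calc ‖𝔉 (p₁ x) - 𝔉 (p₀ x)‖ ≤ B * ‖p₁ x - p₀ x‖ := hmvt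
      _ ≤ max B 0 * lam :=
        mul_le_mul (le_max_left _ _) h0 (norm_nonneg _) (le_max_right _ _)
  | succ j ih =>
    obtain ⟨K, hK0, hK⟩ := ih
    refine ⟨max B 0 + 2 ^ j * (j.factorial * max B 0 * max D 1 ^ j + K * max D 1), by positivity, ?_⟩
    intro F _ _ 𝔉 O V p₀ p₁ x lam hO hVO h𝔉 hB hseg hp₀ hp₁ hD hδ i hi
    have hBmax : max B 0 = B :=
      max_eq_left ((norm_nonneg _).trans (hB _ (hseg (left_mem_segment ℝ _ _)) 1 le_rfl (by omega)))
    have hDmax : max D 1 = D := max_eq_left hD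
    have hD1 : max 1 D = D := max_eq_right hD
    have hlam : 0 ≤ lam := (norm_nonneg _).trans (hδ 0 (Nat.zero_le _))
    have hB0 : 0 ≤ B := by rw [← hBmax]; exact le_max_right _ _
    rw [hBmax, hDmax]
    -- order zero
    rcases Nat.eq_zero_or_pos i with rfl | hi1
    · rw [norm_iteratedFDeriv_zero]
      have h0 := hδ 0 (Nat.zero_le _)
      rw [norm_iteratedFDeriv_zero] at h0
      have hmvt := norm_sub_le_of_segment (m := j + 1) hO h𝔉 (hseg.trans hVO)
        (fun q hq ↦ hB q (hseg hq) 1 le_rfl (by omega))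
      calc ‖𝔉 (p₁ x) - 𝔉 (p₀ x)‖ ≤ B * ‖p₁ x - p₀ x‖ := hmvt
        _ ≤ B * lam := mul_le_mul_of_nonneg_left h0 hB0
        _ ≤ (B + 2 ^ j * (j.factorial * B * D ^ j + K * D)) * lam := by
          apply mul_le_mul_of_nonneg_right _ hlam
          have : 0 ≤ 2 ^ j * (j.factorial * B * D ^ j + K * D) := by positivity
          linarith
    -- positive orders `i = k + 1`
    obtain ⟨k, rfl⟩ := Nat.exists_eq_add_of_le' hi1
    have hk : k ≤ j := by omega
    -- points of the segment lie in the open set of smoothness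
    have hx₀ : p₀ x ∈ O := hVO (hseg (left_mem_segment ℝ _ _))
    have hx₁ : p₁ x ∈ O := hVO (hseg (right_mem_segment ℝ _ _))
    have h𝔉₀ : ContDiffAt ℝ (j + 1 + 1 : ℕ) 𝔉 (p₀ x) := (h𝔉 _ hx₀).contDiffAt (hO.mem_nhds hx₀)
    have h𝔉₁ : ContDiffAt ℝ (j + 1 + 1 : ℕ) 𝔉 (p₁ x) := (h𝔉 _ hx₁).contDiffAt (hO.mem_nhds hx₁)
    -- the derivative kernel `𝔉′ = D𝔉` and its data
    have h𝔉' : ContDiffOn ℝ (j + 1 : ℕ) (fderiv ℝ 𝔉) O :=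
      h𝔉.fderiv_of_isOpen hO (by push_cast; exact le_rfl)
    have hB' : ∀ q ∈ V, ∀ i, 1 ≤ i → i ≤ j + 1 → ‖iteratedFDeriv ℝ i (fderiv ℝ 𝔉) q‖ ≤ B :=
      fun q hq i hi1 hi ↦ by rw [norm_iteratedFDeriv_fderiv]; exact hB q hq (i + 1) (by omega) (by omega)
    -- the chain/difference rule near `x`
    have h𝔉₁' : ContDiffAt ℝ (j + 1 : ℕ) 𝔉 (p₁ x) := h𝔉₁.of_le (by exact_mod_cast Nat.le_succ _)
    have h𝔉₀' : ContDiffAt ℝ (j + 1 : ℕ) 𝔉 (p₀ x) := h𝔉₀.of_le (by exact_mod_cast Nat.le_succ _)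
    have hev : fderiv ℝ (fun y ↦ 𝔉 (p₁ y) - 𝔉 (p₀ y)) =ᶠ[𝓝 x] fun y ↦
        (fderiv ℝ 𝔉 (p₁ y)).comp (fderiv ℝ (fun y ↦ p₁ y - p₀ y) y) +
          (fderiv ℝ 𝔉 (p₁ y) - fderiv ℝ 𝔉 (p₀ y)).comp (fderiv ℝ p₀ y) := by
      have h1 := fderiv_sub_eventuallyEq (f := fun y ↦ 𝔉 (p₁ y)) (g := fun y ↦ 𝔉 (p₀ y)) (m := j)
        (h𝔉₁'.comp x hp₁.1) (h𝔉₀'.comp x hp₀.1)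
      have h2 := fderiv_comp_eventuallyEq (m := j) h𝔉₁' hp₁.1
      have h3 := fderiv_comp_eventuallyEq (m := j) h𝔉₀' hp₀.1
      have h4 := fderiv_sub_eventuallyEq (m := j) hp₁.1 hp₀.1
      filter_upwards [h1, h2, h3, h4] with y hy1 hy2 hy3 hy4
      rw [hy1, hy2, hy3, hy4, comp_sub_comp_eq]
    rw [← norm_iteratedFDeriv_fderiv, (hev.iteratedFDeriv ℝ k).eq_of_nhds]
    -- the `C^{j+1}` kernel `𝔉′` at the two endpoints
    have h𝔉'₁ : ContDiffAt ℝ (j + 1 : ℕ) (fderiv ℝ 𝔉) (p₁ x) :=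
      (h𝔉' _ hx₁).contDiffAt (hO.mem_nhds hx₁)
    have h𝔉'₀ : ContDiffAt ℝ (j + 1 : ℕ) (fderiv ℝ 𝔉) (p₀ x) :=
      (h𝔉' _ hx₀).contDiffAt (hO.mem_nhds hx₀)
    have hp₁k : ContDiffAt ℝ k p₁ x ∧ ∀ i, 1 ≤ i → i ≤ k → ‖iteratedFDeriv ℝ i p₁ x‖ ≤ D :=
      ck₁_mono hp₁ (by omega) le_rfl
    have hp₀k : ContDiffAt ℝ k p₀ x ∧ ∀ i, 1 ≤ i → i ≤ k → ‖iteratedFDeriv ℝ i p₀ x‖ ≤ D :=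
      ck₁_mono hp₀ (by omega) le_rfl
    -- term 1 : `(𝔉′ ∘ p₁) · D(p₁ − p₀)`
    have hg' : ContDiffAt ℝ k (fderiv ℝ 𝔉) (p₁ x) ∧
        ∀ i ≤ k, ‖iteratedFDeriv ℝ i (fderiv ℝ 𝔉) (p₁ x)‖ ≤ B :=
      ⟨h𝔉'₁.of_le (by exact_mod_cast (by omega : k ≤ j + 1)), fun i hi ↦ by
        rw [norm_iteratedFDeriv_fderiv]
        exact hB _ (hseg (right_mem_segment ℝ _ _)) (i + 1) (by omega) (by omega)⟩
    have hT1a := ck_comp hg' hp₁k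
    have hδ' : ContDiffAt ℝ k (fderiv ℝ (fun y ↦ p₁ y - p₀ y)) x ∧
        ∀ i ≤ k, ‖iteratedFDeriv ℝ i (fderiv ℝ (fun y ↦ p₁ y - p₀ y)) x‖ ≤ lam :=
      ck_fderiv ⟨(hp₁.1.sub hp₀.1).of_le (by exact_mod_cast (by omega : k + 1 ≤ j + 1)),
        fun i _ hi ↦ hδ i (by omega)⟩
    have hT1 := ck_clm_comp hT1a hδ'
    -- term 2 : `(𝔉′ ∘ p₁ − 𝔉′ ∘ p₀) · Dp₀`, the induction hypothesis for `𝔉′`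
    have hdiff : ContDiffAt ℝ k (fun y ↦ fderiv ℝ 𝔉 (p₁ y) - fderiv ℝ 𝔉 (p₀ y)) x ∧
        ∀ i ≤ k, ‖iteratedFDeriv ℝ i (fun y ↦ fderiv ℝ 𝔉 (p₁ y) - fderiv ℝ 𝔉 (p₀ y)) x‖ ≤
          K * lam := by
      refine ⟨((h𝔉'₁.of_le (by exact_mod_cast (by omega : k ≤ j + 1))).comp x hp₁k.1).sub
        ((h𝔉'₀.of_le (by exact_mod_cast (by omega : k ≤ j + 1))).comp x hp₀k.1), fun i hi ↦ ?_⟩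
      exact hK hO hVO h𝔉' hB' hseg (ck₁_mono hp₀ (Nat.le_succ j) le_rfl)
        (ck₁_mono hp₁ (Nat.le_succ j) le_rfl) hD (fun i hi ↦ hδ i (by omega)) i (hi.trans hk)
    have hp₀' : ContDiffAt ℝ k (fderiv ℝ p₀) x ∧
        ∀ i ≤ k, ‖iteratedFDeriv ℝ i (fderiv ℝ p₀) x‖ ≤ D :=
      ck_fderiv (ck₁_mono hp₀ (by omega : k + 1 ≤ j + 1) le_rfl)
    have hT2 := ck_clm_comp hdiff hp₀'
    refine ((ck_add hT1 hT2).2 k le_rfl).trans ?_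
    rw [hD1]
    -- arithmetic
    have h2k : (2 : ℝ) ^ k ≤ 2 ^ j := pow_le_pow_right₀ one_le_two hk
    have hfk : (k.factorial : ℝ) ≤ j.factorial := by exact_mod_cast Nat.factorial_le hk
    have hDk : D ^ k ≤ D ^ j := pow_le_pow_right₀ hD hk
    have hD0 : 0 ≤ D := zero_le_one.trans hD
    have e1 : 2 ^ k * (k.factorial * B * D ^ k) * lam ≤ 2 ^ j * (j.factorial * B * D ^ j) * lam := by
      apply mul_le_mul_of_nonneg_right _ hlam
      exact mul_le_mul h2k (mul_le_mul (mul_le_mul_of_nonneg_right hfk hB0) hDk (by positivity)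
        (by positivity)) (by positivity) (by positivity)
    have e2 : 2 ^ k * (K * lam) * D ≤ 2 ^ j * (K * lam) * D :=
      mul_le_mul_of_nonneg_right (mul_le_mul_of_nonneg_right h2k (by positivity)) hD0
    have e3 : 0 ≤ B * lam := by positivity
    calc 2 ^ k * (k.factorial * B * D ^ k) * lam + 2 ^ k * (K * lam) * D
        ≤ 2 ^ j * (j.factorial * B * D ^ j) * lam + 2 ^ j * (K * lam) * D := add_le_add e1 e2
      _ = 2 ^ j * (j.factorial * B * D ^ j + K * D) * lam := by ring
      _ ≤ (B + 2 ^ j * (j.factorial * B * D ^ j + K * D)) * lam := by nlinarith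

/-! ### Leibniz with a large but affine-like second factor -/

/-- **Refined Leibniz bound.** For a bounded bilinear pairing `B` and `i ≥ 1`:
`‖Dⁱ B(f, g)(x)‖ ≤ ‖B‖ (‖Dⁱf(x)‖ ‖g(x)‖ + 2ⁱ C_f G₁)` whenever `‖Dʲf(x)‖ ≤ C_f` (`j ≤ i`) and
`‖Dʲg(x)‖ ≤ G₁` for the POSITIVE orders `1 ≤ j ≤ i` only. The size `‖g(x)‖` (typically large: `g` the
position of the point) multiplies only the top derivative of `f` (typically small: a tame modulus).
[folklore] -/
theorem norm_iteratedFDeriv_bilinear_le_of_pos {H : Type*} [NormedAddCommGroup H] [NormedSpace ℝ H]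
    {n : ℕ} {f : E → F} {g : E → G} {x : E} {Cf G₁ : ℝ} (B : F →L[ℝ] G →L[ℝ] H)
    (hf : ContDiffAt ℝ n f x ∧ ∀ i ≤ n, ‖iteratedFDeriv ℝ i f x‖ ≤ Cf)
    (hg : ContDiffAt ℝ n g x ∧ ∀ i, 1 ≤ i → i ≤ n → ‖iteratedFDeriv ℝ i g x‖ ≤ G₁) {i : ℕ} (hi1 : 1 ≤ i)
    (hi : i ≤ n) :
    ‖iteratedFDeriv ℝ i (fun y ↦ B (f y) (g y)) x‖ ≤
      ‖B‖ * (‖iteratedFDeriv ℝ i f x‖ * ‖g x‖ + 2 ^ i * Cf * G₁) := by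
  obtain ⟨u, hu, hxu, hfu, hgu⟩ := exists_isOpen_contDiffOn₂ hf.1 hg.1
  have h := B.norm_iteratedFDerivWithin_le_of_bilinear (N := (n : ℕ∞)) hfu hgu hu.uniqueDiffOn hxu
    (n := i) (by exact_mod_cast hi)
  rw [iteratedFDerivWithin_of_isOpen i hu hxu] at h
  refine h.trans (mul_le_mul_of_nonneg_left ?_ (norm_nonneg B))
  have hCf : 0 ≤ Cf := ck_nonneg hf
  have hG₁ : 0 ≤ G₁ := (norm_nonneg _).trans (hg.2 1 le_rfl (hi1.trans hi))
  rw [Finset.sum_range_succ, Nat.choose_self, Nat.cast_one, one_mul, Nat.sub_self,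
    iteratedFDerivWithin_of_isOpen i hu hxu, iteratedFDerivWithin_of_isOpen 0 hu hxu,
    norm_iteratedFDeriv_zero, add_comm]
  refine add_le_add le_rfl ?_
  calc ∑ j ∈ Finset.range i, (i.choose j : ℝ) * ‖iteratedFDerivWithin ℝ j f u x‖ *
        ‖iteratedFDerivWithin ℝ (i - j) g u x‖
      ≤ ∑ j ∈ Finset.range i, (i.choose j : ℝ) * (Cf * G₁) := by
        refine Finset.sum_le_sum fun j hj ↦ ?_
        have hji : j < i := Finset.mem_range.mp hj
        rw [mul_assoc]
        refine mul_le_mul_of_nonneg_left ?_ (Nat.cast_nonneg _)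
        rw [iteratedFDerivWithin_of_isOpen j hu hxu, iteratedFDerivWithin_of_isOpen (i - j) hu hxu]
        exact mul_le_mul (hf.2 j (hji.le.trans hi)) (hg.2 (i - j) (by omega) (by omega))
          (norm_nonneg _) hCf
    _ ≤ ∑ j ∈ Finset.range (i + 1), (i.choose j : ℝ) * (Cf * G₁) := by
        refine Finset.sum_le_sum_of_subset_of_nonneg (Finset.range_subset_range.mpr (Nat.le_succ i))
          fun j _ _ ↦ by positivity
    _ = 2 ^ i * Cf * G₁ := by
        rw [← Finset.sum_mul, mul_assoc]
        congr 1
        exact_mod_cast Nat.sum_range_choose i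

/-- The refined Leibniz bound for the application of an operator-valued map to a vector-valued one
(pairing of norm `≤ 1`). [folklore] -/
theorem norm_iteratedFDeriv_clm_apply_le_of_pos {n : ℕ} {f : E → F →L[ℝ] G} {g : E → F} {x : E}
    {Cf G₁ : ℝ} (hf : ContDiffAt ℝ n f x ∧ ∀ i ≤ n, ‖iteratedFDeriv ℝ i f x‖ ≤ Cf)
    (hg : ContDiffAt ℝ n g x ∧ ∀ i, 1 ≤ i → i ≤ n → ‖iteratedFDeriv ℝ i g x‖ ≤ G₁) {i : ℕ} (hi1 : 1 ≤ i)
    (hi : i ≤ n) :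
    ‖iteratedFDeriv ℝ i (fun y ↦ f y (g y)) x‖ ≤ ‖iteratedFDeriv ℝ i f x‖ * ‖g x‖ + 2 ^ i * Cf * G₁ := by
  have h := norm_iteratedFDeriv_bilinear_le_of_pos (ContinuousLinearMap.id ℝ (F →L[ℝ] G)) hf hg hi1 hi
  have h1 : ‖ContinuousLinearMap.id ℝ (F →L[ℝ] G)‖ ≤ 1 := ContinuousLinearMap.norm_id_le
  have h0 : 0 ≤ ‖iteratedFDeriv ℝ i f x‖ * ‖g x‖ + 2 ^ i * Cf * G₁ := by
    have := ck_nonneg hf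
    have : 0 ≤ G₁ := (norm_nonneg _).trans (hg.2 1 le_rfl (hi1.trans hi))
    positivity
  exact h.trans ((mul_le_mul_of_nonneg_right h1 h0).trans (by rw [one_mul]))

end OneHole

/-- Registered sub-goal form (stub `oneHole_ck1_comp_of_small_inner` of the crux item) of
`OneHole.ck₁_comp_of_small_inner`: a composition whose inner function has small derivatives of positive
order has derivatives of positive order bounded linearly in that smallness. [folklore] -/
theorem oneHole_ck1_comp_of_small_inner : ∀ {E F G : Type*} [NormedAddCommGroup E] [NormedSpace ℝ E] [NormedAddCommGroup F] [NormedSpace ℝ F] [NormedAddCommGroup G] [NormedSpace ℝ G] {n : ℕ} {g : F → G} {f : E → F} {x : E} {C δ : ℝ}, (ContDiffAt ℝ (n + 1 : ℕ) g (f x) ∧ ∀ i ≤ n + 1, ‖iteratedFDeriv ℝ i g (f x)‖ ≤ C) → (ContDiffAt ℝ (n + 1 : ℕ) f x ∧ ∀ i, 1 ≤ i → i ≤ n + 1 → ‖iteratedFDeriv ℝ i f x‖ ≤ δ) → δ ≤ 1 → ContDiffAt ℝ (n + 1 : ℕ) (fun y ↦ g (f y)) x ∧ ∀ i, 1 ≤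 i → i ≤ n + 1 → ‖iteratedFDeriv ℝ i (fun y ↦ g (f y)) x‖ ≤ 2 ^ n * n.factorial * C * δ :=
  fun hg hf hδ ↦ OneHole.ck₁_comp_of_small_inner hg hf hδ

end Summit.FinalStateConjecture.FinalStateConjecture.Theorems

end
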